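import Literature.NumberTheory.EllipticCurves.CuspRayIntegrals
import HarnessLib

/-!
# The Mazur–Tate–Teitelbaum distribution of a `U_p`-eigenform in weight `k` (complex-valued)

Topic `Literature/NumberTheory/EllipticCurves`, namespace
`Literature.NumberTheory.EllipticCurves.ModularForms` (continuing `CuspRayIntegrals`).

For `F ∈ S_k(Γ₀(L))` (any weight), a prime `p ∣ L` with `U_p F = α F` (`heckeT (Gamma0 L) k p F = α • F`,
the shape produced by `exists_ordinary_pStabilised_of_isNewform0` for the `p`-stabilisation of an
ordinary newform) and a weight function `Q` of the rescaled ray parameter, the complex numbers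

  `mttDistribution p F α Q n a = α^{−n} ∫₀^∞ F(a/pⁿ + it) Q(pⁿ t) dt`      (`n ≥ 0`, `a ∈ ℤ`)

are the values on `a + pⁿℤ_p` of the distribution of Mazur–Tate–Teitelbaum 1986, §I.10 paired with
the polynomial `(pⁿz − a)ʲ` when `Q(s) = (is)ʲ` (along `z = a/pⁿ + it`, `pⁿ z − a = i pⁿ t`; Bellaïche,
*The Eigenbook*, §6.7.3: `μ(zʲ 1_{a+pⁿℤ_p}) = α^{−n} Φ_F({∞} − {a/pⁿ})((a + pⁿ z)ʲ)`), up to the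
orientation constant of `∫_{a/pⁿ}^{i∞} … dz = i ∫₀^∞ … dt`.  This file proves, with no rationality or
boundedness input:

* `mttDistribution_add_mul_pow` — the value depends on `a` only modulo `pⁿ` (`F(z + 1) = F(z)`);
* `sum_mttDistribution_succ` — **the distribution relation**
  `∑_{b mod p} μ_Q(n+1, a + b pⁿ) = μ_Q(n, a)` (`α ≠ 0`), from the engine
  `sum_integral_cuspRay_div_eq_of_eigen` of `CuspRayIntegrals` (the cusps `(a + bpⁿ)/pⁿ⁺¹ = (a/pⁿ + b)/p`
  are summed by `U_p`, and `Q(pⁿ⁺¹ s/p) = Q(pⁿ s)`), for every `Q` integrable against `F` along the `p`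
  rays — in particular every polynomial weight (`integrableOn_cuspRay_mul_polynomial`,
  `integrableOn_cuspRay_mul_ofReal_pow`: `t ↦ F(r + it) tⁱ` is integrable at rational `r`).

These are the first two of the four properties (additivity, dependence on `a mod pⁿ`, algebraicity with
bounded denominators, interpolation of `L(F, χ, j+1)`) which make `μ_{F,α}` a bounded measure with the
interpolation property of Delbourgo 2008, Thm. 2.2 / Mazur–Tate–Teitelbaum 1986, §I.14 in the ordinary
case; the last two rest on the Eichler–Shimura–Manin rationality of the tree (`PeriodRationalityProofs`)
and are not treated here.  Everything is proved; there are no named facts.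

## References

* B. Mazur, J. Tate, J. Teitelbaum, *On p-adic analogues of the conjectures of Birch and
  Swinnerton-Dyer*, Invent. Math. 84 (1986), §I.10 (the distribution), §I.14. [MazurTateTeitelbaum1986Invent]
* D. Delbourgo, *Elliptic Curves and Big Galois Representations*, LMS LNS 356 (2008), Thm. 2.2. [Delbourgo2008]
* J. Bellaïche, *The Eigenbook*, Pathways in Mathematics, Birkhäuser (2021), §6.7.3, Thm. 6.7.9,
  Cor. 6.7.10.
-/

noncomputable section

open scoped MatrixGroups ModularForm Topology Manifold

open CongruenceSubgroup Complex MeasureTheory Set Filter Function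
open UpperHalfPlane hiding I

namespace Literature.NumberTheory.EllipticCurves.ModularForms

variable {L : ℕ} [NeZero L] {k : ℤ}

/-- Powers of the real parameter against a cusp form at a rational cusp are integrable:
`t ↦ f(r + it) tⁱ` on `(0, ∞)` (`t = -i((r + it) - r)`, a polynomial in `r + it`). [folklore] -/
theorem integrableOn_cuspRay_mul_ofReal_pow (f : CuspForm (Gamma0 L) k) (r : ℚ) (i : ℕ) :
    IntegrableOn (fun t : ℝ ↦ f (ofComplex ((r : ℂ) + t * I)) * (t : ℂ) ^ i) (Ioi 0) := by
  have key : ∀ t : ℝ, f (ofComplex ((r : ℂ) + t * I)) * (t : ℂ) ^ i =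
      ∑ m ∈ Finset.range (i + 1), ((-I) ^ i * (-(r : ℂ)) ^ (i - m) * (i.choose m : ℂ)) *
        (f (ofComplex ((r : ℂ) + t * I)) * ((r : ℂ) + t * I) ^ m) := by
    intro t
    have hx : (t : ℂ) = (-I) * (((r : ℂ) + t * I) + (-(r : ℂ))) := by
      ring_nf
      rw [I_sq]
      ring
    have ht : (t : ℂ) ^ i = ∑ m ∈ Finset.range (i + 1),
        ((-I) ^ i * (-(r : ℂ)) ^ (i - m) * (i.choose m : ℂ)) * ((r : ℂ) + t * I) ^ m := by
      conv_lhs => rw [hx]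
      rw [mul_pow, add_pow, Finset.mul_sum]
      refine Finset.sum_congr rfl fun m _ ↦ ?_
      ring
    rw [ht, Finset.mul_sum]
    refine Finset.sum_congr rfl fun m _ ↦ ?_
    ring
  simp_rw [key]
  exact integrable_finsetSum _ fun m _ ↦ (integrableOn_cuspRay_mul_pow_rat f r m).const_mul _

/-- **Integrability against polynomial weights of the rescaled parameter**: for `P ∈ ℂ[X]`, `c ∈ ℝ`
and a rational cusp `r`, `t ↦ f(r + it) P(ct)` is integrable on `(0, ∞)`. [folklore] -/
theorem integrableOn_cuspRay_mul_polynomial (f : CuspForm (Gamma0 L) k) (r : ℚ) (P : Polynomial ℂ)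
    (c : ℝ) :
    IntegrableOn (fun t : ℝ ↦ f (ofComplex ((r : ℂ) + t * I)) * P.eval (((c * t : ℝ)) : ℂ)) (Ioi 0) := by
  have key : ∀ t : ℝ, f (ofComplex ((r : ℂ) + t * I)) * P.eval (((c * t : ℝ)) : ℂ) =
      ∑ m ∈ Finset.range (P.natDegree + 1), (P.coeff m * (c : ℂ) ^ m) *
        (f (ofComplex ((r : ℂ) + t * I)) * (t : ℂ) ^ m) := by
    intro t
    rw [Polynomial.eval_eq_sum_range, Finset.mul_sum]
    refine Finset.sum_congr rfl fun m _ ↦ ?_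
    push_cast
    ring
  simp_rw [key]
  exact integrable_finsetSum _ fun m _ ↦ (integrableOn_cuspRay_mul_ofReal_pow f r m).const_mul _

variable (p : ℕ) [NeZero p]

/-- **The Mazur–Tate–Teitelbaum distribution of `(F, α)` in weight `k`, complex-valued, against a
weight function `Q` of the rescaled ray parameter**:
`mttDistribution F p α Q n a = α^{−n} ∫₀^∞ F(a/pⁿ + it) Q(pⁿ t) dt`.  Along the ray `z = a/pⁿ + it`
one has `pⁿ z − a = i pⁿ t`, so for `Q(s) = (is)ʲ` this is `α^{−n} (1/i) ∫_{a/pⁿ}^{i∞} F(z)(pⁿz − a)ʲ dz`,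
the value `μ_{F,α}((pⁿ z − a)ʲ 1_{a + pⁿℤ_p})` of the distribution of Mazur–Tate–Teitelbaum 1986, §I.10
in the form of Bellaïche, *The Eigenbook*, §6.7.3 (`μ(zʲ 1_{a+pⁿℤ_p}) = α^{−n} Φ_F({∞} − {a/pⁿ})((a + pⁿz)ʲ)`),
up to the orientation constant.  It depends on `a` only modulo `pⁿ` (`mttDistribution_add_mul_pow`) and
is additive under refinement of `a + pⁿℤ_p` into the `p` cosets `a + bpⁿ + pⁿ⁺¹ℤ_p` when
`U_p F = α F` (`sum_mttDistribution_succ`). [cite: MazurTateTeitelbaum1986Invent, §I.10] -/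
def mttDistribution (F : CuspForm (Gamma0 L) k) (α : ℂ) (Q : ℝ → ℂ) (n : ℕ) (a : ℤ) : ℂ :=
  (α ^ n)⁻¹ * ∫ t in Ioi (0 : ℝ),
    F (ofComplex ((((a : ℝ) / (p : ℝ) ^ n : ℝ) : ℂ) + t * I)) * Q ((p : ℝ) ^ n * t)

variable {p}

omit [NeZero L] [NeZero p] in
/-- Unfolding lemma. [folklore] -/
theorem mttDistribution_def (F : CuspForm (Gamma0 L) k) (α : ℂ) (Q : ℝ → ℂ) (n : ℕ) (a : ℤ) :
    mttDistribution p F α Q n a = (α ^ n)⁻¹ * ∫ t in Ioi (0 : ℝ),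
      F (ofComplex ((((a : ℝ) / (p : ℝ) ^ n : ℝ) : ℂ) + t * I)) * Q ((p : ℝ) ^ n * t) :=
  rfl

/-- **`μ` depends on `a` only modulo `pⁿ`**: `F(z + m) = F(z)` for `m ∈ ℤ`. [folklore] -/
theorem mttDistribution_add_mul_pow (F : CuspForm (Gamma0 L) k) (α : ℂ) (Q : ℝ → ℂ) (n : ℕ)
    (a m : ℤ) :
    mttDistribution p F α Q n (a + m * (p : ℤ) ^ n) = mttDistribution p F α Q n a := by
  have hp0 : (p : ℝ) ≠ 0 := by exact_mod_cast NeZero.ne p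
  have hper := ((isCuspFunction_one F).periodic.int_mul m)
  simp only [mttDistribution_def]
  congr 1
  refine setIntegral_congr_fun measurableSet_Ioi fun t _ ↦ ?_
  have hpC : (p : ℂ) ≠ 0 := by exact_mod_cast NeZero.ne p
  have e : ((((a + m * (p : ℤ) ^ n : ℤ) : ℝ) / (p : ℝ) ^ n : ℝ) : ℂ) + t * I =
      ((((a : ℝ) / (p : ℝ) ^ n : ℝ) : ℂ) + t * I) + (m : ℂ) * ((1 : ℝ) : ℂ) := by
    push_cast
    field_simp
    ring
  have h := hper ((((a : ℝ) / (p : ℝ) ^ n : ℝ) : ℂ) + t * I)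
  simp only [comp_apply] at h
  rw [e, h]

/-- **Additivity (distribution relation) of the Mazur–Tate–Teitelbaum distribution**: if `p ∣ L` is
prime and `U_p F = α F` with `α ≠ 0`, then for every weight function `Q` (integrable against `F` along
the `p` rays, e.g. a polynomial, `integrableOn_cuspRay_mul_polynomial`)
`∑_{b mod p} μ_Q(n+1, a + b pⁿ) = μ_Q(n, a)`: the cusps `(a + bpⁿ)/pⁿ⁺¹ = (a/pⁿ + b)/p` are summed by
the engine `sum_integral_cuspRay_div_eq_of_eigen`, and `Q(pⁿ⁺¹ · s/p) = Q(pⁿ s)`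
(Mazur–Tate–Teitelbaum 1986, §I.10, Prop.; Bellaïche, *The Eigenbook*, §6.7.3). [cite: MazurTateTeitelbaum1986Invent, §I.10] -/
theorem sum_mttDistribution_succ (hp : p.Prime) (hpL : p ∣ L) (F : CuspForm (Gamma0 L) k) {α : ℂ}
    (hU : heckeT (Gamma0 L) k p F = α • F) (hα : α ≠ 0) (Q : ℝ → ℂ) (n : ℕ) (a : ℤ)
    (hint : ∀ b : Fin p, IntegrableOn (fun t : ℝ ↦
      F (ofComplex (((((a : ℝ) / (p : ℝ) ^ n + b) / p : ℝ) : ℂ) + t * I)) *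
        Q ((p : ℝ) ^ (n + 1) * t)) (Ioi 0)) :
    ∑ b : Fin p, mttDistribution p F α Q (n + 1) (a + b * (p : ℤ) ^ n) =
      mttDistribution p F α Q n a := by
  have hp0 : (p : ℝ) ≠ 0 := by exact_mod_cast hp.ne_zero
  have hpC : (p : ℂ) ≠ 0 := by exact_mod_cast hp.ne_zero
  simp only [mttDistribution_def]
  -- the cusps `(a + b pⁿ)/pⁿ⁺¹ = (a/pⁿ + b)/p`
  have e : ∀ b : Fin p, ((((a + b * (p : ℤ) ^ n : ℤ) : ℝ) / (p : ℝ) ^ (n + 1) : ℝ) : ℂ) =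
      (((((a : ℝ) / (p : ℝ) ^ n + b) / p : ℝ)) : ℂ) := by
    intro b
    push_cast
    field_simp
    ring
  simp_rw [e]
  rw [← Finset.mul_sum, sum_integral_cuspRay_div_eq_of_eigen hp hpL F hU _ _ hint, ← mul_assoc,
    pow_succ, mul_inv, mul_assoc (α ^ n)⁻¹, inv_mul_cancel₀ hα, mul_one]
  congr 1
  refine setIntegral_congr_fun measurableSet_Ioi fun s _ ↦ ?_
  congr 2
  rw [pow_succ]
  field_simp


/-- **The distribution relation for polynomial weights** (hypothesis-free form of
`sum_mttDistribution_succ`): for `P ∈ ℂ[X]`, `Q(s) = P(s)`,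
`∑_{b mod p} μ_Q(n+1, a + b pⁿ) = μ_Q(n, a)`. [cite: MazurTateTeitelbaum1986Invent, §I.10] -/
theorem sum_mttDistribution_succ_polynomial (hp : p.Prime) (hpL : p ∣ L) (F : CuspForm (Gamma0 L) k)
    {α : ℂ} (hU : heckeT (Gamma0 L) k p F = α • F) (hα : α ≠ 0) (P : Polynomial ℂ) (n : ℕ) (a : ℤ) :
    ∑ b : Fin p, mttDistribution p F α (fun s ↦ P.eval (s : ℂ)) (n + 1) (a + b * (p : ℤ) ^ n) =
      mttDistribution p F α (fun s ↦ P.eval (s : ℂ)) n a := by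
  refine sum_mttDistribution_succ hp hpL F hU hα _ n a fun b ↦ ?_
  -- the cusp `(a/pⁿ + b)/p` is the rational number `r`
  set r : ℚ := ((a : ℚ) / (p : ℚ) ^ n + (b : ℕ)) / p with hr
  have hrR : (((a : ℝ) / (p : ℝ) ^ n + b) / p : ℝ) = (r : ℝ) := by
    rw [hr]; push_cast; ring
  have h := integrableOn_cuspRay_mul_polynomial F r P ((p : ℝ) ^ (n + 1))
  refine h.congr_fun (fun t _ ↦ ?_) measurableSet_Ioi
  simp only [hrR, ofReal_ratCast]

omit [NeZero L] [NeZero p] in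
/-- **Normalisation at `n = 0`**: against `Q(s) = (is)ʲ`, `μ_Q(0, 0) = ∫₀^∞ F(it)(it)ʲ dt = iʲ Λ(F, j+1)`
(`completedLValue`; with `rayMoment_zero`, `= ∫_0^{i∞} F(z) zʲ dz / i`). [cite: PasolPopa2013, eq. (5.7)] -/
theorem mttDistribution_zero_zero_I_mul_pow (F : CuspForm (Gamma0 L) k) (α : ℂ) (j : ℕ) :
    mttDistribution p F α (fun s : ℝ ↦ (I * s) ^ j) 0 0 = I ^ j * completedLValue F (j + 1) := by
  rw [mttDistribution_def, completedLValue_def, Nat.add_sub_cancel, pow_zero, inv_one, one_mul,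
    ← integral_const_mul]
  refine setIntegral_congr_fun measurableSet_Ioi fun t _ ↦ ?_
  simp only [Int.cast_zero, zero_div, ofReal_zero, zero_add, pow_zero, one_mul, mul_pow]
  ring

end Literature.NumberTheory.EllipticCurves.ModularForms

end
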